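import Summits.Ventures.Crystal3D.Theorems.StickyWulffConstantGenericWallFloorSiteLedger
import Summits.Ventures.Crystal3D.Theorems.StickyWulffConstantCoaxialWallLawDoubleVacancyLattice
import Summits.Ventures.Crystal3D.Theorems.StickyWulffConstantCoaxialWallLawTripleVacancyLattice
import Summits.Ventures.Crystal3D.Theorems.StickyWulffConstantGenericWallFloorSharedTriangle
import Summits.Ventures.Crystal3D.Theorems.StickyWulffConstantNoReconstructionGainOffLatticeMoved
import HarnessLib

/-!
# Non-saturation of a lattice ball with a vacant slot (rigid rung of `GenericWallFloor`, module M5)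

HONEST FRAMING. Part of the venture `Summits/Ventures/Crystal3D` (cell `crystal3d-full`), helper
`--supports` the crux `GenericWallFloor` (stmt-Ventures-19480, `route-Ventures-StickyWulffConstant`),
REGISTERED line `WallLedgerG` (planner cf-p1 gen 16), stub `stub_twoSlabAdhesion`, RIGID-BICRYSTAL
RUNG (architecture RIGID-RUNG-ARCH of prover 19480-p1 on the item).  This file proves IN THE KERNEL the
module that the rung so far held only as a certified computation (M5-CERT, kit j282218 / j282453):
NON-SATURATION AT NON-COINCIDENCE SITES.  Rung credit only; nothing here is the crux.

**Theorem (`card_foreign_add_one_le_card_empty`, ledger form; `nonsaturation_offCoincidence`, degree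
form).**  Let `Λ₁ = A₁·Λ₀ + t₁`, `Λ₂ = A₂·Λ₀ + t₂` be moved fcc lattices which are NOT co-axial (the
hypothesis of `GenericWallFloor` / `TwoSlabAdhesion`, verbatim), `X` a finite `1`-separated
configuration, and `p ∈ X ∩ Λ₁`, `p ∉ Λ₂`, a ball all of whose FOREIGN neighbours (points of `X` at
distance `1` not on `Λ₁`) lie on `Λ₂` — e.g. any ball of a rigid bicrystal `X ⊆ Λ₁ ∪ Λ₂`.  If `p` has
at least one EMPTY slot, then `#foreign neighbours + 1 ≤ #empty slots`, i.e. `deg p ≤ 11`.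
One ball, no cell, no plates, no `ρ`; constants: none (the form (i) asked for by the texture line,
card HOME/cf-p1/route/lines/wall/WallLedger.md §C).

Proof = the vacancy atoms of the sibling line `WallLedgerF` (prover 19481-p1) + L3′ + the shared-triangle
criterion: with `e` empty slots and `c` foreign neighbours,
* `e ≥ 4`: `c ≤ 3` by L3′ (`fcc_offLattice_unitContacts_le_three_moved`: a point off `Λ₂` touches at
  most three points of `Λ₂`);
* `e = 1`: `c = 0` (`two_le_card_empty_slots_of_foreign`: one foreign neighbour blocks two slots);
* `e = 2`: `c ≤ 1` (`fcc_double_vacancy_moved`: two compatible contacts avoiding the ten occupied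
  slots ARE the two vacant sites, hence not foreign);
* `e = 3`: `c ≤ 2`, for three compatible foreign contacts avoiding nine occupied slots are the TWIN
  TRIPLE over a triangular face (`fcc_triple_vacancy_moved`, 19481-p1), whose pairwise differences are two
  adjacent slot vectors of `Λ₁`; lying on `Λ₂` they exhibit a unit triangle common to both lattices,
  so the pair is co-axial (`coaxial_of_shared_adjacent_slots`) — excluded.
WHAT THIS IS NOT: the coincidence case `p ∈ Λ₁ ∩ Λ₂` with `≥ 4` vacancies (module M7); the rung; the
stub; rung F-C1 not moved.
-/

noncomputable section

namespace Summit.Ventures.Crystal3D.Theorems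

open Summit.Ventures.Crystal3D Finset
open Literature.MathematicalPhysics.StatisticalMechanics (barlowPos barlowStacking fccStacking
  constHagg IsHaggSeq)
open scoped InnerProductSpace

/-- A slot site `p + A w` (`w ∈ fccSlots`) of a lattice ball `p ∈ A·Λ₀ + t` is a lattice point at
distance `1` from `p`. -/
theorem slotSite_mem_dist (A : EuclideanSpace ℝ (Fin 3) ≃ₗᵢ[ℝ] EuclideanSpace ℝ (Fin 3))
    (t p w : EuclideanSpace ℝ (Fin 3))
    (hp : p ∈ (fun x => A x + t) '' fccStacking 1 (Real.sqrt (2 / 3))) (hw : w ∈ fccSlots) :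
    p + A w ∈ (fun x => A x + t) '' fccStacking 1 (Real.sqrt (2 / 3)) ∧ dist p (p + A w) = 1 := by
  refine ⟨movedFcc_add_site_mem A t hp (mem_fcc_of_mem_fccSlots hw), ?_⟩
  rw [dist_eq_norm, sub_add_cancel_left, norm_neg, LinearIsometryEquiv.norm_map,
    norm_eq_one_of_mem_fccSlots hw]

/-- **Occupied unless vacant.**  A nearest-neighbour site `z` of `p` in `A·Λ₀ + t` whose slot
`A⁻¹(z − p)` is not among the EMPTY slots of `p` in `X` is a point of `X`. -/
theorem mem_of_slot_not_mem_empty (A : EuclideanSpace ℝ (Fin 3) ≃ₗᵢ[ℝ] EuclideanSpace ℝ (Fin 3))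
    (t p z : EuclideanSpace ℝ (Fin 3)) (X : Finset (EuclideanSpace ℝ (Fin 3)))
    (hp : p ∈ (fun x => A x + t) '' fccStacking 1 (Real.sqrt (2 / 3)))
    (hz : z ∈ (fun x => A x + t) '' fccStacking 1 (Real.sqrt (2 / 3))) (hpz : dist p z = 1)
    (h : A.symm (z - p) ∉ fccSlots.filter (fun w => p + A w ∉ X)) : z ∈ X := by
  classical
  have hw := symm_sub_mem_fccSlots A t p z hp hz hpz
  by_contra hzX
  apply h
  rw [mem_filter]
  refine ⟨hw, ?_⟩
  rwa [LinearIsometryEquiv.apply_symm_apply, add_sub_cancel]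

open scoped Classical in
/-- **Two vacancies admit at most one foreign neighbour.**  If the lattice ball `p ∈ A·Λ₀ + t` of the
`1`-separated configuration `X` has exactly two empty slots, then at most one point of `X` at distance
`1` from `p` lies off the lattice (`fcc_double_vacancy_moved`). -/
theorem card_foreign_le_one_of_card_empty_eq_two
    (A : EuclideanSpace ℝ (Fin 3) ≃ₗᵢ[ℝ] EuclideanSpace ℝ (Fin 3)) (t p : EuclideanSpace ℝ (Fin 3))
    (X : Finset (EuclideanSpace ℝ (Fin 3)))
    (hp : p ∈ (fun x => A x + t) '' fccStacking 1 (Real.sqrt (2 / 3)))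
    (hsep : ∀ x ∈ X, ∀ y ∈ X, x ≠ y → 1 ≤ dist x y)
    (he : (fccSlots.filter fun w => p + A w ∉ X).card = 2) :
    (X.filter fun q => dist p q = 1 ∧
      q ∉ (fun x => A x + t) '' fccStacking 1 (Real.sqrt (2 / 3))).card ≤ 1 := by
  classical
  set Λ : Set (EuclideanSpace ℝ (Fin 3)) := (fun x => A x + t) '' fccStacking 1 (Real.sqrt (2 / 3))
    with hΛ
  obtain ⟨w₁, w₂, hne, hE⟩ := Finset.card_eq_two.1 he
  have hw₁E : w₁ ∈ fccSlots.filter fun w => p + A w ∉ X := by rw [hE]; simp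
  have hw₂E : w₂ ∈ fccSlots.filter fun w => p + A w ∉ X := by rw [hE]; simp
  have hw₁ : w₁ ∈ fccSlots := (mem_filter.1 hw₁E).1
  have hw₂ : w₂ ∈ fccSlots := (mem_filter.1 hw₂E).1
  obtain ⟨hz₁Λ, hpz₁⟩ := slotSite_mem_dist A t p w₁ hp hw₁
  obtain ⟨hz₂Λ, hpz₂⟩ := slotSite_mem_dist A t p w₂ hp hw₂
  have hz12 : p + A w₁ ≠ p + A w₂ := by
    intro h; exact hne (A.injective (add_left_cancel h))
  -- every other nearest-neighbour site is occupied
  have hocc : ∀ z ∈ Λ, dist p z = 1 → z ≠ p + A w₁ → z ≠ p + A w₂ → z ∈ X := by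
    intro z hz hpz h1 h2
    refine mem_of_slot_not_mem_empty A t p z X hp hz hpz ?_
    rw [hE]
    simp only [mem_insert, mem_singleton, not_or]
    constructor
    · intro h; apply h1; rw [← h, LinearIsometryEquiv.apply_symm_apply, add_sub_cancel]
    · intro h; apply h2; rw [← h, LinearIsometryEquiv.apply_symm_apply, add_sub_cancel]
  rw [Finset.card_le_one]
  intro q hq q' hq'
  by_contra hqq'
  obtain ⟨hqX, hpq, hqΛ⟩ := mem_filter.1 hq
  obtain ⟨hq'X, hpq', hq'Λ⟩ := mem_filter.1 hq'
  have hyy' : 1 ≤ dist q q' := hsep q hqX q' hq'X hqq'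
  have key := fcc_double_vacancy_moved A t p q q' (p + A w₁) (p + A w₂) hp hz₁Λ hz₂Λ hpz₁ hpz₂ hz12
    hpq hpq' hyy' (by
      intro z hz hpz h1 h2
      have hzX := hocc z hz hpz h1 h2
      exact ⟨hsep q hqX z hzX (fun h => hqΛ (h ▸ hz)), hsep q' hq'X z hzX (fun h => hq'Λ (h ▸ hz))⟩)
  rcases key with ⟨h, -⟩ | ⟨h, -⟩
  · exact hqΛ (h ▸ hz₁Λ)
  · exact hqΛ (h ▸ hz₂Λ)

open scoped Classical in
/-- **Triple-vacancy lemma, pair form, for a moved lattice `A·Λ₀ + t`** (corollary of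
`fcc_triple_vacancy_moved`, prover 19481-p1).  `q ∈ A·Λ₀ + t` with three pairwise distinct
nearest-neighbour sites `z₁, z₂, z₃`; `y, y', y''` off the lattice touch `q`, are pairwise at distance
`≥ 1` and keep distance `≥ 1` from every other nearest-neighbour site of `q`.  Then `dist y y' = 1` and
`y − y'` is a lattice VECTOR, `y − y' ∈ A(Λ₀)`: the three are the twin triple over a triangular face,
and two twin positions differ by the difference of two face sites. -/
theorem fcc_triple_vacancy_pair_moved
    (A : EuclideanSpace ℝ (Fin 3) ≃ₗᵢ[ℝ] EuclideanSpace ℝ (Fin 3)) (t : EuclideanSpace ℝ (Fin 3))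
    (q y y' y'' z₁ z₂ z₃ : EuclideanSpace ℝ (Fin 3))
    (hq : q ∈ (fun p => A p + t) '' fccStacking 1 (Real.sqrt (2 / 3)))
    (hz₁ : z₁ ∈ (fun p => A p + t) '' fccStacking 1 (Real.sqrt (2 / 3)))
    (hz₂ : z₂ ∈ (fun p => A p + t) '' fccStacking 1 (Real.sqrt (2 / 3)))
    (hz₃ : z₃ ∈ (fun p => A p + t) '' fccStacking 1 (Real.sqrt (2 / 3)))
    (hqz₁ : dist q z₁ = 1) (hqz₂ : dist q z₂ = 1) (hqz₃ : dist q z₃ = 1)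
    (h12 : z₁ ≠ z₂) (h13 : z₁ ≠ z₃) (h23 : z₂ ≠ z₃)
    (hyΛ : y ∉ (fun p => A p + t) '' fccStacking 1 (Real.sqrt (2 / 3)))
    (hy'Λ : y' ∉ (fun p => A p + t) '' fccStacking 1 (Real.sqrt (2 / 3)))
    (hy''Λ : y'' ∉ (fun p => A p + t) '' fccStacking 1 (Real.sqrt (2 / 3)))
    (hy : dist q y = 1) (hy' : dist q y' = 1) (hy'' : dist q y'' = 1)
    (hyy' : 1 ≤ dist y y') (hyy'' : 1 ≤ dist y y'') (hy'y'' : 1 ≤ dist y' y'')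
    (h : ∀ z ∈ (fun p => A p + t) '' fccStacking 1 (Real.sqrt (2 / 3)), dist q z = 1 → z ≠ z₁ →
      z ≠ z₂ → z ≠ z₃ → 1 ≤ dist y z ∧ 1 ≤ dist y' z ∧ 1 ≤ dist y'' z) :
    dist y y' = 1 ∧ y - y' ∈ A '' fccStacking 1 (Real.sqrt (2 / 3)) := by
  obtain ⟨⟨d12, d13, d23⟩, Dy, Dy', -⟩ := fcc_triple_vacancy_moved A t q y y' y'' z₁ z₂ z₃ hq hz₁ hz₂ hz₃
    hqz₁ hqz₂ hqz₃ h12 h13 h23 hy hy' hy'' hyΛ hy'Λ hy''Λ hyy' hyy'' hy'y'' h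
  set S := (2 / 3 : ℝ) • (z₁ + z₂ + z₃) with hS
  -- off-diagonal case: `y = S − zᵢ`, `y' = S − zⱼ`, `dist zᵢ zⱼ = 1`
  have offdiag : ∀ zi zj : EuclideanSpace ℝ (Fin 3),
      zi ∈ (fun p => A p + t) '' fccStacking 1 (Real.sqrt (2 / 3)) →
      zj ∈ (fun p => A p + t) '' fccStacking 1 (Real.sqrt (2 / 3)) → dist zi zj = 1 →
      y = S - zi → y' = S - zj → dist y y' = 1 ∧ y - y' ∈ A '' fccStacking 1 (Real.sqrt (2 / 3)) := by
    intro zi zj hzi hzj hd e e'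
    have hsub : y - y' = zj - zi := by rw [e, e']; abel
    refine ⟨?_, ?_⟩
    · rw [dist_eq_norm, hsub, ← dist_eq_norm, dist_comm]; exact hd
    · rw [hsub]; exact sub_mem_image_of_mem_affine A t zj zi hzj hzi
  -- diagonal case: `y = y'`, contradicting `dist y y' ≥ 1`
  have diag : ∀ zi : EuclideanSpace ℝ (Fin 3), y = S - zi → y' = S - zi →
      dist y y' = 1 ∧ y - y' ∈ A '' fccStacking 1 (Real.sqrt (2 / 3)) := by
    intro zi e e'
    exfalso
    have : y = y' := by rw [e, e']
    rw [this, dist_self] at hyy'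
    linarith
  have d21 : dist z₂ z₁ = 1 := by rw [dist_comm]; exact d12
  have d31 : dist z₃ z₁ = 1 := by rw [dist_comm]; exact d13
  have d32 : dist z₃ z₂ = 1 := by rw [dist_comm]; exact d23
  rcases Dy with e | e | e <;> rcases Dy' with e' | e' | e'
  · exact diag z₁ e e'
  · exact offdiag z₁ z₂ hz₁ hz₂ d12 e e'
  · exact offdiag z₁ z₃ hz₁ hz₃ d13 e e'
  · exact offdiag z₂ z₁ hz₂ hz₁ d21 e e'
  · exact diag z₂ e e'
  · exact offdiag z₂ z₃ hz₂ hz₃ d23 e e'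
  · exact offdiag z₃ z₁ hz₃ hz₁ d31 e e'
  · exact offdiag z₃ z₂ hz₃ hz₂ d32 e e'
  · exact diag z₃ e e'

open scoped Classical in
/-- **Three vacancies and three foreign neighbours on a second lattice force co-axiality.**  If the
lattice ball `p ∈ Λ₁ = A₁·Λ₀ + t₁` of the `1`-separated `X` has exactly three empty slots and three
(pairwise distinct) foreign neighbours lying on `Λ₂ = A₂·Λ₀ + t₂`, then `Λ₁, Λ₂` are co-axial:
the three are the twin triple over a triangular face (`fcc_triple_vacancy_pair_moved`), so their
differences form a unit triangle of slot vectors common to both lattices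
(`coaxial_of_shared_adjacent_slots`). -/
theorem coaxial_of_card_empty_eq_three
    (A₁ A₂ : EuclideanSpace ℝ (Fin 3) ≃ₗᵢ[ℝ] EuclideanSpace ℝ (Fin 3))
    (t₁ t₂ p : EuclideanSpace ℝ (Fin 3)) (X : Finset (EuclideanSpace ℝ (Fin 3)))
    (hp : p ∈ (fun x => A₁ x + t₁) '' fccStacking 1 (Real.sqrt (2 / 3)))
    (hsep : ∀ x ∈ X, ∀ y ∈ X, x ≠ y → 1 ≤ dist x y)
    (hfor : ∀ q ∈ X, dist p q = 1 → q ∉ (fun x => A₁ x + t₁) '' fccStacking 1 (Real.sqrt (2 / 3)) →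
      q ∈ (fun x => A₂ x + t₂) '' fccStacking 1 (Real.sqrt (2 / 3)))
    (he : (fccSlots.filter fun w => p + A₁ w ∉ X).card = 3)
    (hc : 3 ≤ (X.filter fun q => dist p q = 1 ∧
      q ∉ (fun x => A₁ x + t₁) '' fccStacking 1 (Real.sqrt (2 / 3))).card) :
    ∃ (L : EuclideanSpace ℝ (Fin 3) ≃ₗᵢ[ℝ] EuclideanSpace ℝ (Fin 3))
      (s₁ s₂ : EuclideanSpace ℝ (Fin 3)) (σ σ' : ℤ → ℤ), IsHaggSeq σ ∧ IsHaggSeq σ' ∧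
      (fun x => A₁ x + t₁) '' fccStacking 1 (Real.sqrt (2 / 3)) ⊆
        (fun x => L x + s₁) '' barlowStacking 1 (Real.sqrt (2 / 3)) σ ∧
      (fun x => A₂ x + t₂) '' fccStacking 1 (Real.sqrt (2 / 3)) ⊆
        (fun x => L x + s₂) '' barlowStacking 1 (Real.sqrt (2 / 3)) σ' := by
  classical
  set Λ₁ : Set (EuclideanSpace ℝ (Fin 3)) := (fun x => A₁ x + t₁) '' fccStacking 1 (Real.sqrt (2 / 3))
    with hΛ₁
  obtain ⟨w₁, w₂, w₃, hn12, hn13, hn23, hE⟩ := Finset.card_eq_three.1 he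
  have hwE : ∀ w, w = w₁ ∨ w = w₂ ∨ w = w₃ → w ∈ fccSlots.filter fun w => p + A₁ w ∉ X := by
    intro w hw; rw [hE]; simp only [mem_insert, mem_singleton]; exact hw
  have hw₁ : w₁ ∈ fccSlots := (mem_filter.1 (hwE w₁ (Or.inl rfl))).1
  have hw₂ : w₂ ∈ fccSlots := (mem_filter.1 (hwE w₂ (Or.inr (Or.inl rfl)))).1
  have hw₃ : w₃ ∈ fccSlots := (mem_filter.1 (hwE w₃ (Or.inr (Or.inr rfl)))).1
  obtain ⟨hz₁Λ, hpz₁⟩ := slotSite_mem_dist A₁ t₁ p w₁ hp hw₁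
  obtain ⟨hz₂Λ, hpz₂⟩ := slotSite_mem_dist A₁ t₁ p w₂ hp hw₂
  obtain ⟨hz₃Λ, hpz₃⟩ := slotSite_mem_dist A₁ t₁ p w₃ hp hw₃
  have hzne : ∀ {w w' : EuclideanSpace ℝ (Fin 3)}, w ≠ w' → p + A₁ w ≠ p + A₁ w' := by
    intro w w' hne h; exact hne (A₁.injective (add_left_cancel h))
  -- every other nearest-neighbour site is occupied
  have hocc : ∀ z ∈ Λ₁, dist p z = 1 → z ≠ p + A₁ w₁ → z ≠ p + A₁ w₂ → z ≠ p + A₁ w₃ → z ∈ X := by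
    intro z hz hpz h1 h2 h3
    refine mem_of_slot_not_mem_empty A₁ t₁ p z X hp hz hpz ?_
    rw [hE]
    simp only [mem_insert, mem_singleton, not_or]
    refine ⟨?_, ?_, ?_⟩
    · intro h; apply h1; rw [← h, LinearIsometryEquiv.apply_symm_apply, add_sub_cancel]
    · intro h; apply h2; rw [← h, LinearIsometryEquiv.apply_symm_apply, add_sub_cancel]
    · intro h; apply h3; rw [← h, LinearIsometryEquiv.apply_symm_apply, add_sub_cancel]
  -- three distinct foreign neighbours
  obtain ⟨q₁, q₂, q₃, hq₁, hq₂, hq₃, hq12, hq13, hq23⟩ := Finset.two_lt_card_iff.1 hc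
  obtain ⟨hq₁X, hpq₁, hq₁Λ⟩ := mem_filter.1 hq₁
  obtain ⟨hq₂X, hpq₂, hq₂Λ⟩ := mem_filter.1 hq₂
  obtain ⟨hq₃X, hpq₃, hq₃Λ⟩ := mem_filter.1 hq₃
  have hq₁₂ : q₁ ∈ (fun x => A₂ x + t₂) '' fccStacking 1 (Real.sqrt (2 / 3)) := hfor q₁ hq₁X hpq₁ hq₁Λ
  have hq₂₂ : q₂ ∈ (fun x => A₂ x + t₂) '' fccStacking 1 (Real.sqrt (2 / 3)) := hfor q₂ hq₂X hpq₂ hq₂Λ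
  have hq₃₂ : q₃ ∈ (fun x => A₂ x + t₂) '' fccStacking 1 (Real.sqrt (2 / 3)) := hfor q₃ hq₃X hpq₃ hq₃Λ
  have d12 := hsep q₁ hq₁X q₂ hq₂X hq12
  have d13 := hsep q₁ hq₁X q₃ hq₃X hq13
  have d23 := hsep q₂ hq₂X q₃ hq₃X hq23
  have d21 : 1 ≤ dist q₂ q₁ := by rw [dist_comm]; exact d12
  have d31 : 1 ≤ dist q₃ q₁ := by rw [dist_comm]; exact d13
  have d32 : 1 ≤ dist q₃ q₂ := by rw [dist_comm]; exact d23
  -- the occupied sites are at distance ≥ 1 from each foreign neighbour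
  have hfar : ∀ q, q ∈ X → q ∉ Λ₁ → ∀ z ∈ Λ₁, dist p z = 1 → z ≠ p + A₁ w₁ → z ≠ p + A₁ w₂ →
      z ≠ p + A₁ w₃ → 1 ≤ dist q z := by
    intro q hqX hqΛ z hz hpz h1 h2 h3
    exact hsep q hqX z (hocc z hz hpz h1 h2 h3) (fun h => hqΛ (h ▸ hz))
  have hall : ∀ z ∈ Λ₁, dist p z = 1 → z ≠ p + A₁ w₁ → z ≠ p + A₁ w₂ → z ≠ p + A₁ w₃ →
      1 ≤ dist q₁ z ∧ 1 ≤ dist q₂ z ∧ 1 ≤ dist q₃ z := fun z hz hpz h1 h2 h3 =>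
    ⟨hfar q₁ hq₁X hq₁Λ z hz hpz h1 h2 h3, hfar q₂ hq₂X hq₂Λ z hz hpz h1 h2 h3,
      hfar q₃ hq₃X hq₃Λ z hz hpz h1 h2 h3⟩
  -- pair lemma, three times
  obtain ⟨e12, ha₁⟩ := fcc_triple_vacancy_pair_moved A₁ t₁ p q₁ q₂ q₃ (p + A₁ w₁) (p + A₁ w₂) (p + A₁ w₃)
    hp hz₁Λ hz₂Λ hz₃Λ hpz₁ hpz₂ hpz₃ (hzne hn12) (hzne hn13) (hzne hn23) hq₁Λ hq₂Λ hq₃Λ hpq₁ hpq₂ hpq₃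
    d12 d13 d23 hall
  obtain ⟨e13, hb₁⟩ := fcc_triple_vacancy_pair_moved A₁ t₁ p q₁ q₃ q₂ (p + A₁ w₁) (p + A₁ w₂) (p + A₁ w₃)
    hp hz₁Λ hz₂Λ hz₃Λ hpz₁ hpz₂ hpz₃ (hzne hn12) (hzne hn13) (hzne hn23) hq₁Λ hq₃Λ hq₂Λ hpq₁ hpq₃ hpq₂
    d13 d12 d32 (fun z hz hpz h1 h2 h3 =>
      let h := hall z hz hpz h1 h2 h3; ⟨h.1, h.2.2, h.2.1⟩)
  obtain ⟨e23, -⟩ := fcc_triple_vacancy_pair_moved A₁ t₁ p q₂ q₃ q₁ (p + A₁ w₁) (p + A₁ w₂) (p + A₁ w₃)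
    hp hz₁Λ hz₂Λ hz₃Λ hpz₁ hpz₂ hpz₃ (hzne hn12) (hzne hn13) (hzne hn23) hq₂Λ hq₃Λ hq₁Λ hpq₂ hpq₃ hpq₁
    d23 d21 d31 (fun z hz hpz h1 h2 h3 =>
      let h := hall z hz hpz h1 h2 h3; ⟨h.2.1, h.2.2, h.1⟩)
  -- the shared unit triangle `a = q₁ − q₂`, `b = q₁ − q₃`
  set a := q₁ - q₂ with ha
  set b := q₁ - q₃ with hb
  have han : ‖a‖ = 1 := by rw [ha, ← dist_eq_norm]; exact e12
  have hbn : ‖b‖ = 1 := by rw [hb, ← dist_eq_norm]; exact e13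
  have habn : ‖a - b‖ = 1 := by
    have : a - b = q₃ - q₂ := by rw [ha, hb]; abel
    rw [this, ← dist_eq_norm, dist_comm]; exact e23
  have hab : ⟪a, b⟫_ℝ = 1 / 2 := by
    have h := norm_sub_sq_real a b
    rw [habn, han, hbn] at h
    linarith
  have ha₂ : a ∈ A₂ '' fccStacking 1 (Real.sqrt (2 / 3)) := sub_mem_image_of_mem_affine A₂ t₂ q₁ q₂ hq₁₂ hq₂₂
  have hb₂ : b ∈ A₂ '' fccStacking 1 (Real.sqrt (2 / 3)) := sub_mem_image_of_mem_affine A₂ t₂ q₁ q₃ hq₁₂ hq₃₂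
  exact coaxial_of_shared_adjacent_slots A₁ A₂ t₁ t₂ a b ha₁ hb₁ ha₂ hb₂ han hbn hab

open scoped Classical in
/-- **Non-saturation at a non-coincidence site, ledger form (module M5 of the rigid rung).**
`Λ₁, Λ₂` NOT co-axial (hypothesis of `TwoSlabAdhesion` verbatim), `X` finite and `1`-separated,
`p ∈ Λ₁ ∖ Λ₂` a point whose foreign neighbours in `X` (distance `1`, off `Λ₁`) all lie on `Λ₂`, with
at least one empty slot.  Then `#foreign neighbours + 1 ≤ #empty slots`. -/
theorem card_foreign_add_one_le_card_empty
    (A₁ A₂ : EuclideanSpace ℝ (Fin 3) ≃ₗᵢ[ℝ] EuclideanSpace ℝ (Fin 3))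
    (t₁ t₂ p : EuclideanSpace ℝ (Fin 3)) (X : Finset (EuclideanSpace ℝ (Fin 3)))
    (hnc : ¬ ∃ (L : EuclideanSpace ℝ (Fin 3) ≃ₗᵢ[ℝ] EuclideanSpace ℝ (Fin 3))
        (s₁ s₂ : EuclideanSpace ℝ (Fin 3)) (σ σ' : ℤ → ℤ), IsHaggSeq σ ∧ IsHaggSeq σ' ∧
        (fun x => A₁ x + t₁) '' fccStacking 1 (Real.sqrt (2 / 3)) ⊆
          (fun x => L x + s₁) '' barlowStacking 1 (Real.sqrt (2 / 3)) σ ∧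
        (fun x => A₂ x + t₂) '' fccStacking 1 (Real.sqrt (2 / 3)) ⊆
          (fun x => L x + s₂) '' barlowStacking 1 (Real.sqrt (2 / 3)) σ')
    (hp₁ : p ∈ (fun x => A₁ x + t₁) '' fccStacking 1 (Real.sqrt (2 / 3)))
    (hp₂ : p ∉ (fun x => A₂ x + t₂) '' fccStacking 1 (Real.sqrt (2 / 3)))
    (hsep : ∀ x ∈ X, ∀ y ∈ X, x ≠ y → 1 ≤ dist x y)
    (hfor : ∀ q ∈ X, dist p q = 1 → q ∉ (fun x => A₁ x + t₁) '' fccStacking 1 (Real.sqrt (2 / 3)) →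
      q ∈ (fun x => A₂ x + t₂) '' fccStacking 1 (Real.sqrt (2 / 3)))
    (he : 1 ≤ (fccSlots.filter fun w => p + A₁ w ∉ X).card) :
    (X.filter fun q => dist p q = 1 ∧
        q ∉ (fun x => A₁ x + t₁) '' fccStacking 1 (Real.sqrt (2 / 3))).card + 1 ≤
      (fccSlots.filter fun w => p + A₁ w ∉ X).card := by
  classical
  set e := (fccSlots.filter fun w => p + A₁ w ∉ X).card with he_def
  set F := X.filter fun q => dist p q = 1 ∧
    q ∉ (fun x => A₁ x + t₁) '' fccStacking 1 (Real.sqrt (2 / 3)) with hF_def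
  -- L3′: at most three foreign neighbours (they lie on Λ₂, and p does not)
  have hc3 : F.card ≤ 3 :=
    fcc_offLattice_unitContacts_le_three_moved A₂ t₂ p hp₂ F (fun q hq => by
      obtain ⟨hqX, hpq, hqΛ⟩ := mem_filter.1 hq
      exact ⟨hfor q hqX hpq hqΛ, hpq⟩)
  by_cases h4 : 4 ≤ e
  · omega
  -- one vacancy: no foreign neighbour
  by_cases h1 : e = 1
  · have hF0 : F.card = 0 := by
      rw [Finset.card_eq_zero, Finset.eq_empty_iff_forall_notMem]
      intro q hq
      obtain ⟨hqX, hpq, hqΛ⟩ := mem_filter.1 hq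
      have h2 := two_le_card_empty_slots_of_foreign A₁ t₁ p q X hp₁ hqΛ hpq hqX hsep
      omega
    omega
  by_cases h2 : e = 2
  · have hF1 : F.card ≤ 1 := card_foreign_le_one_of_card_empty_eq_two A₁ t₁ p X hp₁ hsep h2
    omega
  have h3 : e = 3 := by omega
  by_contra hlt
  have hc : 3 ≤ F.card := by omega
  exact hnc (coaxial_of_card_empty_eq_three A₁ A₂ t₁ t₂ p X hp₁ hsep hfor h3 hc)

open scoped Classical in
/-- **Non-saturation at a non-coincidence site, degree form.**  Under the hypotheses of
`card_foreign_add_one_le_card_empty`, the ball `p` has at most eleven neighbours in `X`: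
`#{q ∈ X : dist p q = 1} ≤ 11`.  (A top site of the rigid rung's steepest-class ledger is such a
ball: its up-slot is empty; for a non-co-axial pair it therefore always carries `12 − deg ≥ 1`.) -/
theorem nonsaturation_offCoincidence
    (A₁ A₂ : EuclideanSpace ℝ (Fin 3) ≃ₗᵢ[ℝ] EuclideanSpace ℝ (Fin 3))
    (t₁ t₂ p : EuclideanSpace ℝ (Fin 3)) (X : Finset (EuclideanSpace ℝ (Fin 3)))
    (hnc : ¬ ∃ (L : EuclideanSpace ℝ (Fin 3) ≃ₗᵢ[ℝ] EuclideanSpace ℝ (Fin 3))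
        (s₁ s₂ : EuclideanSpace ℝ (Fin 3)) (σ σ' : ℤ → ℤ), IsHaggSeq σ ∧ IsHaggSeq σ' ∧
        (fun x => A₁ x + t₁) '' fccStacking 1 (Real.sqrt (2 / 3)) ⊆
          (fun x => L x + s₁) '' barlowStacking 1 (Real.sqrt (2 / 3)) σ ∧
        (fun x => A₂ x + t₂) '' fccStacking 1 (Real.sqrt (2 / 3)) ⊆
          (fun x => L x + s₂) '' barlowStacking 1 (Real.sqrt (2 / 3)) σ')
    (hp₁ : p ∈ (fun x => A₁ x + t₁) '' fccStacking 1 (Real.sqrt (2 / 3)))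
    (hp₂ : p ∉ (fun x => A₂ x + t₂) '' fccStacking 1 (Real.sqrt (2 / 3)))
    (hsep : ∀ x ∈ X, ∀ y ∈ X, x ≠ y → 1 ≤ dist x y)
    (hfor : ∀ q ∈ X, dist p q = 1 → q ∉ (fun x => A₁ x + t₁) '' fccStacking 1 (Real.sqrt (2 / 3)) →
      q ∈ (fun x => A₂ x + t₂) '' fccStacking 1 (Real.sqrt (2 / 3)))
    (he : 1 ≤ (fccSlots.filter fun w => p + A₁ w ∉ X).card) :
    (X.filter fun q => dist p q = 1).card ≤ 11 := by
  classical
  have h := card_foreign_add_one_le_card_empty A₁ A₂ t₁ t₂ p X hnc hp₁ hp₂ hsep hfor he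
  have h12 := twelve_sub_degree_eq A₁ t₁ p X hp₁
  have : ((X.filter fun q => dist p q = 1 ∧
        q ∉ (fun x => A₁ x + t₁) '' fccStacking 1 (Real.sqrt (2 / 3))).card : ℤ) + 1 ≤
      ((fccSlots.filter fun w => p + A₁ w ∉ X).card : ℤ) := by exact_mod_cast h
  omega

end Summit.Ventures.Crystal3D.Theorems

end
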